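import Summits.ResolutionOfSingularities.ResolutionOfSingularities.Theorems.FrobeniusLadderFInjectiveMacaulayficationT11PlusFedderData
import Summits.ResolutionOfSingularities.ResolutionOfSingularities.Theorems.FrobeniusLadderFInjectiveMacaulayficationDoublePointFedderOdd
import Mathlib.Algebra.CharP.Lemmas
import Mathlib.Algebra.Ring.GeomSum
import Mathlib.RingTheory.MvPolynomial.Basic
import Mathlib.Tactic.Ring
import Mathlib.Tactic.LinearCombination
import HarnessLib

/-!
# The CI Fedder witness for `T⁽⁴⁾⁺ = V(Φ − y² − x³, z² + Φ³ + w⁷ + v⁸ + x¹²) ⊂ 𝔸⁶` at its three singular points off the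
# vertex stratum, characteristic `7` (crux `FInjectiveMacaulayfication`, K-T4, «T4plus hoff», first half)

Support file for crux stmt-ResolutionOfSingularities-15315 (`FrobeniusLadder.FInjectiveMacaulayfication`), chain w45a,
seat res-L1-w45a-stub-4 (res-L1-w45a-plan-1 R12.9 (b) «GO T4plus hoff»). [OURS · L1 W4.5a] — NOT a statement of the
manuscript [claim: Hironaka2017]; AI-written, weaker than expert review.

THE SPECIMEN (idea-1's key re-embedding of `T⁽⁴⁾ = z² + (y²+x³)³ + w⁷ + v⁸ + x¹²`): `F₁ = Φ − y² − x³`,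
`F₂ = z² + Φ³ + w⁷ + v⁸ + x¹²` in `k[x,y,z,w,v,Φ] = MvPolynomial (Fin 6) k` (this order, the convention of
`T4PlusPrime.t4plus_prime_and_X_ne_zero`), `p = 7`. Off the stratum `V(x, Φ)` the variety `X = V(F₁,F₂)` is regular except at
the three points `x³ = 1, y = z = v = 0, Φ = 1, w⁷ = −2` (all `𝔽₇`-rational: `x ∈ {1,2,4}`, `w = 5`), where the `2 × 2` minors
of `∂(F₁,F₂)` all vanish (`T4PlusOffStratum`). THE DECISION (R12.9 (b), deliverable 1): **these points are F-pure** — after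
eliminating `Φ` the local equation is `z² + 3y² + 4a·x² + (order ≥ 3) + t⁷ + v⁸` (`a = x(b)`, `t = w − 5`), a NON-DEGENERATE
double point, and Fedder's element `(F₁F₂)⁶` of the complete intersection [Fedder1983, Prop. 2.1], translated to such a point
`b`, contains the monomial `s_y⁶ s_z⁶ s_Φ⁶` with coefficient `−10800 ≡ 1 (mod 7)`: three binomial peelings (`y²` in `F₁`,
`z²` in `F₂`, then the one-variable identity `Φ³(Φ³+3Φ²+3Φ)³ = 27Φ⁶ + Φ⁷·(…)`), after discarding the multiples of
`s_w⁷`, `s_v⁸` and `s_x` which cannot touch an `x,w,v`-free monomial (`coeff_eq_of_X_pow_dvd_sub`). Hence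
`((F₁F₂) ⊗ K)⁶ ∉ ((Xᵢ − bᵢ)⁷)` at every such `K`-point `b` (translation `Xᵢ ↦ Xᵢ + bᵢ` +
`DoublePointFedder.mem_span_X_pow_iff`), the input of the residue-point dictionary
`FrobeniusPowerOfFedderAt.frobeniusPower_of_fedderAt` (C3a).

* §1 `coeff_eq_of_X_pow_dvd_sub` — a coefficient `d` with `d_s < N` does not see multiples of `X_s^N`;
* §2 the peelings `peel_y`, `peel_z`, `expand_P` (`ring` identities) and the coefficient `−10800` of `y⁶z⁶Φ⁶` in
  `((Φ − y²)(z² + Φ³ + 3Φ² + 3Φ))⁶` (`coeff_step_P`, `coeff_step_z`, `coeff_core`);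
* §3 `coeff_translate` — the same coefficient for the translated element, `a³ = 1`, `c⁷ = −2`;
* §4 `fedder_circle_core`, `t4Plus_fedder_circle` — Fedder's test at the three points, for `Fs` over `k` and `b` over a
  `k`-field `K`.

No definitions, no named facts. [cite: Fedder1983, Prop. 1.7 and Prop. 2.1 (criterion); the computation is OURS,
cross-checked in-seat by compute/decide_circle.py of this seat (72 surviving monomials mod `(s⁷)`, this one with coefficient 1)]
-/

-- single-problem summit: the doubled namespace component is forced
set_option linter.dupNamespace false

noncomputable section

namespace Summit.ResolutionOfSingularities.ResolutionOfSingularities.Theorems.FInjectiveMacaulayfication.T4PlusFedderData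

open MvPolynomial
open Summit.ResolutionOfSingularities.ResolutionOfSingularities.Theorems.FInjectiveMacaulayfication
open HFedderCertificates ThreefoldG3Prime T11PlusFedderData

/-! ## §1 Coefficients do not see multiples of `X_s^N` -/

/-- If `X_s^N ∣ P − Q` then `P` and `Q` have the same `d`-coefficient for every `d` with `d_s < N`. [folklore] -/
theorem coeff_eq_of_X_pow_dvd_sub {σ R : Type*} [CommRing R] (d : σ →₀ ℕ) (s : σ) (N : ℕ) (hN : d s < N)
    {P Q : MvPolynomial σ R} (h : X s ^ N ∣ P - Q) : coeff d P = coeff d Q := by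
  obtain ⟨G, hG⟩ := h
  have hP : P = Q + X s ^ N * G := by rw [← hG]; ring
  rw [hP, coeff_add, coeff_X_pow_mul_eq_zero d s N hN, add_zero]

/-- Powers: if `X_s^N ∣ P − Q` then `coeff d (P^m) = coeff d (Q^m)` for `d_s < N`. [folklore] -/
theorem coeff_pow_eq_of_X_pow_dvd_sub {σ R : Type*} [CommRing R] (d : σ →₀ ℕ) (s : σ) (N : ℕ) (hN : d s < N)
    {P Q : MvPolynomial σ R} (h : X s ^ N ∣ P - Q) (m : ℕ) : coeff d (P ^ m) = coeff d (Q ^ m) :=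
  coeff_eq_of_X_pow_dvd_sub d s N hN (h.trans (sub_dvd_pow_sub_pow P Q m))

/-! ## §2 The coefficient `−10800` of `y⁶z⁶Φ⁶` in `((Φ − y²)(z² + Φ³ + 3Φ² + 3Φ))⁶`, by peeling -/

/-- First peeling, by `y`-degree: `((P − y²)B)⁶`. [folklore] -/
theorem peel_y {R : Type*} [CommRing R] (y P B : R) :
    ((P - y ^ 2) * B) ^ 6 =
      y ^ 8 * (B ^ 6 * (15 * P ^ 2 - 6 * y ^ 2 * P + y ^ 4)) +
      (-20) * (y ^ 6 * (P ^ 3 * B ^ 6)) +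
      15 * (y ^ 4 * (P ^ 4 * B ^ 6)) +
      (-6) * (y ^ 2 * (P ^ 5 * B ^ 6)) +
      y ^ 0 * (P ^ 6 * B ^ 6) := by
  ring

/-- Second peeling, by `z`-degree: `P³(z² + g)⁶`. [folklore] -/
theorem peel_z {R : Type*} [CommRing R] (z P g : R) :
    P ^ 3 * (z ^ 2 + g) ^ 6 =
      z ^ 8 * (P ^ 3 * (15 * g ^ 2 + 6 * z ^ 2 * g + z ^ 4)) +
      20 * (z ^ 6 * (P ^ 3 * g ^ 3)) +
      15 * (z ^ 4 * (P ^ 3 * g ^ 4)) +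
      6 * (z ^ 2 * (P ^ 3 * g ^ 5)) +
      z ^ 0 * (P ^ 3 * g ^ 6) := by
  ring

/-- Last expansion: `Φ³(Φ³ + 3Φ² + 3Φ)³ = 27Φ⁶ + Φ⁷·(…)`. [folklore] -/
theorem expand_P {R : Type*} [CommRing R] (P : R) :
    P ^ 3 * (P ^ 3 + 3 * P ^ 2 + 3 * P) ^ 3 =
      27 * P ^ 6 + P ^ 7 * (P ^ 5 + 9 * P ^ 4 + 36 * P ^ 3 + 81 * P ^ 2 + 108 * P + 81) := by
  ring

section Coeff

variable {K : Type} [Field K]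

/-- Monomials of `K[X₀,…,X₅]` from exponent vectors. [folklore] -/
theorem monomial_six (a b c d e f : ℕ) :
    (monomial (Finsupp.equivFunOnFinite.symm ![a, b, c, d, e, f]) (1 : K) : MvPolynomial (Fin 6) K) =
      X 0 ^ a * X 1 ^ b * X 2 ^ c * X 3 ^ d * X 4 ^ e * X 5 ^ f := by
  rw [monomial_eq, C_1, one_mul, Finsupp.prod_fintype _ _ (fun i => pow_zero _)]
  simp only [Fin.prod_univ_six, Finsupp.coe_equivFunOnFinite_symm, Matrix.cons_val_zero, Matrix.cons_val_one,
    Matrix.cons_val]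

/-- `coeff_{Φ⁶} (Φ³(Φ³+3Φ²+3Φ)³) = 27`. [folklore] -/
theorem coeff_step_P :
    coeff (Finsupp.equivFunOnFinite.symm ![0, 0, 0, 0, 0, 6])
      (X 5 ^ 3 * (X 5 ^ 3 + 3 * X 5 ^ 2 + 3 * X 5) ^ 3 : MvPolynomial (Fin 6) K) = 27 := by
  rw [expand_P, coeff_add, coeff_X_pow_mul_eq_zero _ 5 7 (by simp), add_zero]
  have hm : (X 5 ^ 6 : MvPolynomial (Fin 6) K) = monomial (Finsupp.equivFunOnFinite.symm ![0, 0, 0, 0, 0, 6]) 1 := by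
    rw [monomial_six]; simp
  rw [hm, show (27 : MvPolynomial (Fin 6) K) = C 27 from (map_ofNat C 27).symm, coeff_C_mul, coeff_monomial, if_pos rfl,
    mul_one]

/-- `coeff_{z⁶Φ⁶} (Φ³(z² + g)⁶) = 540`, `g = Φ³ + 3Φ² + 3Φ` (second peeling: only the `z⁶`-term survives). [folklore] -/
theorem coeff_step_z :
    coeff (Finsupp.equivFunOnFinite.symm ![0, 0, 6, 0, 0, 6])
      (X 5 ^ 3 * (X 2 ^ 2 + (X 5 ^ 3 + 3 * X 5 ^ 2 + 3 * X 5)) ^ 6 : MvPolynomial (Fin 6) K) = 540 := by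
  have h25 : (2 : Fin 6) ≠ 5 := by decide
  have hP : (2 : Fin 6) ∉ (X 5 : MvPolynomial (Fin 6) K).vars := notMem_vars_X h25
  have hg : (2 : Fin 6) ∉ (X 5 ^ 3 + 3 * X 5 ^ 2 + 3 * X 5 : MvPolynomial (Fin 6) K).vars :=
    notMem_vars_add (notMem_vars_add (notMem_vars_pow hP 3) (notMem_vars_mul (notMem_vars_ofNat 3) (notMem_vars_pow hP 2)))
      (notMem_vars_mul (notMem_vars_ofNat 3) hP)
  have hfree : ∀ j : ℕ, (2 : Fin 6) ∉ (X 5 ^ 3 * (X 5 ^ 3 + 3 * X 5 ^ 2 + 3 * X 5) ^ j : MvPolynomial (Fin 6) K).vars :=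
    fun j => notMem_vars_mul (notMem_vars_pow hP 3) (notMem_vars_pow hg j)
  rw [peel_z, coeff_add, coeff_add, coeff_add, coeff_add, coeff_X_pow_mul_eq_zero _ 2 8 (by simp)]
  rw [show (20 : MvPolynomial (Fin 6) K) = C 20 from (map_ofNat C 20).symm,
    show (15 : MvPolynomial (Fin 6) K) = C 15 from (map_ofNat C 15).symm,
    show (6 : MvPolynomial (Fin 6) K) = C 6 from (map_ofNat C 6).symm, coeff_C_mul, coeff_C_mul, coeff_C_mul]
  rw [coeff_X_pow_mul_of_notMem_vars _ 2 6 _ (hfree 3), coeff_X_pow_mul_of_notMem_vars _ 2 4 _ (hfree 4),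
    coeff_X_pow_mul_of_notMem_vars _ 2 2 _ (hfree 5), coeff_X_pow_mul_of_notMem_vars _ 2 0 _ (hfree 6)]
  simp only [Finsupp.coe_equivFunOnFinite_symm, Matrix.cons_val]
  norm_num
  have hsub : (Finsupp.equivFunOnFinite.symm ![0, 0, 6, 0, 0, 6] : Fin 6 →₀ ℕ) - Finsupp.single 2 6 =
      Finsupp.equivFunOnFinite.symm ![0, 0, 0, 0, 0, 6] := by
    ext i
    fin_cases i <;> simp
  rw [hsub, coeff_step_P]
  norm_num

/-- **`coeff_{y⁶z⁶Φ⁶} (((Φ − y²)(z² + Φ³ + 3Φ² + 3Φ))⁶) = −10800`** (`≡ 1 mod 7`; first peeling: only the `y⁶`-term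
survives). [folklore] -/
theorem coeff_core :
    coeff (Finsupp.equivFunOnFinite.symm ![0, 6, 6, 0, 0, 6])
      (((X 5 - X 1 ^ 2) * (X 2 ^ 2 + (X 5 ^ 3 + 3 * X 5 ^ 2 + 3 * X 5))) ^ 6 : MvPolynomial (Fin 6) K) = -10800 := by
  have h15 : (1 : Fin 6) ≠ 5 := by decide
  have h12 : (1 : Fin 6) ≠ 2 := by decide
  have hP : (1 : Fin 6) ∉ (X 5 : MvPolynomial (Fin 6) K).vars := notMem_vars_X h15
  have hB : (1 : Fin 6) ∉ (X 2 ^ 2 + (X 5 ^ 3 + 3 * X 5 ^ 2 + 3 * X 5) : MvPolynomial (Fin 6) K).vars :=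
    notMem_vars_add (notMem_vars_pow (notMem_vars_X h12) 2)
      (notMem_vars_add (notMem_vars_add (notMem_vars_pow hP 3) (notMem_vars_mul (notMem_vars_ofNat 3) (notMem_vars_pow hP 2)))
        (notMem_vars_mul (notMem_vars_ofNat 3) hP))
  have hfree : ∀ i : ℕ, (1 : Fin 6) ∉
      (X 5 ^ i * (X 2 ^ 2 + (X 5 ^ 3 + 3 * X 5 ^ 2 + 3 * X 5)) ^ 6 : MvPolynomial (Fin 6) K).vars :=
    fun i => notMem_vars_mul (notMem_vars_pow hP i) (notMem_vars_pow hB 6)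
  rw [peel_y, coeff_add, coeff_add, coeff_add, coeff_add, coeff_X_pow_mul_eq_zero _ 1 8 (by simp)]
  rw [show (-20 : MvPolynomial (Fin 6) K) = C (-20) by rw [map_neg, map_ofNat],
    show (15 : MvPolynomial (Fin 6) K) = C 15 from (map_ofNat C 15).symm,
    show (-6 : MvPolynomial (Fin 6) K) = C (-6) by rw [map_neg, map_ofNat], coeff_C_mul, coeff_C_mul, coeff_C_mul]
  rw [coeff_X_pow_mul_of_notMem_vars _ 1 6 _ (hfree 3), coeff_X_pow_mul_of_notMem_vars _ 1 4 _ (hfree 4),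
    coeff_X_pow_mul_of_notMem_vars _ 1 2 _ (hfree 5), coeff_X_pow_mul_of_notMem_vars _ 1 0 _ (hfree 6)]
  simp only [Finsupp.coe_equivFunOnFinite_symm, Matrix.cons_val_one, Matrix.cons_val_zero]
  norm_num
  have hsub : (Finsupp.equivFunOnFinite.symm ![0, 6, 6, 0, 0, 6] : Fin 6 →₀ ℕ) - Finsupp.single 1 6 =
      Finsupp.equivFunOnFinite.symm ![0, 0, 6, 0, 0, 6] := by
    ext i
    fin_cases i <;> simp
  rw [hsub, coeff_step_z]
  norm_num

end Coeff

/-! ## §3 The same coefficient for the element translated to a point of the circle -/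

section Translate

variable {K : Type} [Field K] [CharP K 7]

/-- **`coeff_{y⁶z⁶Φ⁶}` of the translated Fedder factor is `−10800`**: for `a³ = 1`, `c⁷ = −2`, the product
`(Φ+1 − y² − (x+a)³)·(z² + (Φ+1)³ + (w+c)⁷ + v⁸ + (x+a)¹²)` raised to the `6`-th power has the same `y⁶z⁶Φ⁶`-coefficient as
`((Φ − y²)(z² + Φ³ + 3Φ² + 3Φ))⁶`: the multiples of `w⁷` (`(w+c)⁷ = w⁷ + c⁷` in characteristic `7`), of `v⁸` and of `x`
(`x ∣ (x+a)³ − 1`, `x ∣ (x+a)¹² − 1`, `c⁷ + 2 = 0`) are invisible to this coefficient (§1). [folklore] -/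
theorem coeff_translate (a c : K) (ha : a ^ 3 = 1) (hc : c ^ 7 = -2) :
    coeff (Finsupp.equivFunOnFinite.symm ![0, 6, 6, 0, 0, 6])
      (((X 5 + 1 - X 1 ^ 2 - (X 0 + C a) ^ 3) *
        (X 2 ^ 2 + (X 5 + 1) ^ 3 + (X 3 + C c) ^ 7 + X 4 ^ 8 + (X 0 + C a) ^ 12)) ^ 6 : MvPolynomial (Fin 6) K) =
      -10800 := by
  haveI : Fact (Nat.Prime 7) := ⟨by norm_num⟩
  set T : MvPolynomial (Fin 6) K := X 5 + 1 - X 1 ^ 2 - (X 0 + C a) ^ 3 with hT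
  set A : MvPolynomial (Fin 6) K := X 2 ^ 2 + (X 5 + 1) ^ 3 + C (c ^ 7) + (X 0 + C a) ^ 12 with hA
  -- steps 1 and 2: the multiples of `w⁷` and `v⁸`
  have h7 : (X 3 + C c : MvPolynomial (Fin 6) K) ^ 7 = X 3 ^ 7 + C (c ^ 7) := by
    rw [add_pow_char, map_pow]
  have step1 : (X 3 : MvPolynomial (Fin 6) K) ^ 7 ∣
      T * (X 2 ^ 2 + (X 5 + 1) ^ 3 + (X 3 + C c) ^ 7 + X 4 ^ 8 + (X 0 + C a) ^ 12) - T * (A + X 4 ^ 8) :=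
    ⟨T, by rw [h7, hA]; ring⟩
  have step2 : (X 4 : MvPolynomial (Fin 6) K) ^ 8 ∣ T * (A + X 4 ^ 8) - T * A := ⟨T, by ring⟩
  -- step 3: the multiples of `x`
  have ha3 : (C a : MvPolynomial (Fin 6) K) ^ 3 = 1 := by rw [← map_pow, ha, map_one]
  have hc7 : (C (c ^ 7) : MvPolynomial (Fin 6) K) = -2 := by rw [hc, map_neg, map_ofNat]
  have hu : (X 0 : MvPolynomial (Fin 6) K) ∣ (X 0 + C a) ^ 3 - 1 :=
    ⟨X 0 ^ 2 + 3 * X 0 * C a + 3 * C a ^ 2, by linear_combination ha3⟩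
  have hu12 : (X 0 : MvPolynomial (Fin 6) K) ∣ (X 0 + C a) ^ 12 - 1 := by
    have h := sub_dvd_pow_sub_pow ((X 0 + C a : MvPolynomial (Fin 6) K) ^ 3) 1 4
    rw [one_pow, ← pow_mul] at h
    exact hu.trans h
  have step3 : (X 0 : MvPolynomial (Fin 6) K) ^ 1 ∣
      T * A - (X 5 - X 1 ^ 2) * (X 2 ^ 2 + (X 5 ^ 3 + 3 * X 5 ^ 2 + 3 * X 5)) := by
    have key : T * A - (X 5 - X 1 ^ 2) * (X 2 ^ 2 + (X 5 ^ 3 + 3 * X 5 ^ 2 + 3 * X 5)) =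
        (X 5 - X 1 ^ 2) * ((X 0 + C a) ^ 12 - 1) - ((X 0 + C a) ^ 3 - 1) * A := by
      rw [hT, hA, hc7]; ring
    rw [pow_one, key]
    exact dvd_sub (hu12.mul_left _) (hu.mul_right _)
  rw [coeff_pow_eq_of_X_pow_dvd_sub _ 3 7 (by simp) step1 6, coeff_pow_eq_of_X_pow_dvd_sub _ 4 8 (by simp) step2 6,
    coeff_pow_eq_of_X_pow_dvd_sub _ 0 1 (by simp) step3 6, coeff_core]

/-! ## §4 Fedder's test at the three singular points off the vertex stratum, characteristic `7` -/

/-- `−10800 ≠ 0` in characteristic `7` (`10800 = 7·1542 + 6`). [folklore] -/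
theorem neg_10800_ne_zero : (-10800 : K) ≠ 0 := by
  intro h
  have h' : ((10800 : ℕ) : K) = 0 := by exact_mod_cast (neg_eq_zero.mp h)
  rw [CharP.cast_eq_zero_iff K 7] at h'
  omega

/-- **Fedder's test for the complete intersection `T⁽⁴⁾⁺` at a point `b` of the singular circle** — `b = (a, 0, 0, c, 0, 1)`
with `a³ = 1`, `c⁷ = −2`, coefficients in `K` itself: `((Φ−y²−x³)(z²+Φ³+w⁷+v⁸+x¹²))⁶ ∉ ((Xᵢ − bᵢ)⁷)`. Translation
`Xᵢ ↦ Xᵢ + bᵢ` carries `((Xᵢ − bᵢ)⁷)` onto the monomial ideal `(Xᵢ⁷)` (`DoublePointFedder.mem_span_X_pow_iff`), and the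
translated element has the monomial `y⁶z⁶Φ⁶` (§3). [cite: Fedder1983, Prop. 1.7 and Prop. 2.1] -/
theorem fedder_circle_core (b : Fin 6 → K) (h1 : b 1 = 0) (h2 : b 2 = 0) (h4 : b 4 = 0) (hx : b 0 ^ 3 = 1)
    (h5 : b 5 = 1) (hw : b 3 ^ 7 = -2) :
    ((X 5 - X 1 ^ 2 - X 0 ^ 3) * (X 2 ^ 2 + X 5 ^ 3 + X 3 ^ 7 + X 4 ^ 8 + X 0 ^ 12) : MvPolynomial (Fin 6) K) ^ (7 - 1) ∉
      Ideal.span (Set.range fun i : Fin 6 => (X i - C (b i) : MvPolynomial (Fin 6) K) ^ 7) := by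
  intro hmem
  -- translate by `b`
  let τ : MvPolynomial (Fin 6) K →ₐ[K] MvPolynomial (Fin 6) K := aeval fun i => X i + C (b i)
  have hτ : ∀ i : Fin 6, τ (X i - C (b i)) = X i := fun i => by simp [τ]
  have hmap : (Ideal.span (Set.range fun i : Fin 6 => (X i - C (b i) : MvPolynomial (Fin 6) K) ^ 7)).map τ ≤
      Ideal.span (Set.range fun i : Fin 6 => (X i : MvPolynomial (Fin 6) K) ^ 7) := by
    rw [Ideal.map_span, Ideal.span_le]
    rintro _ ⟨_, ⟨i, rfl⟩, rfl⟩
    refine Ideal.subset_span ⟨i, ?_⟩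
    simp only [map_pow, hτ]
  have hmem' := hmap (Ideal.mem_map_of_mem τ hmem)
  have hE : τ ((X 5 - X 1 ^ 2 - X 0 ^ 3) * (X 2 ^ 2 + X 5 ^ 3 + X 3 ^ 7 + X 4 ^ 8 + X 0 ^ 12)) =
      (X 5 + 1 - X 1 ^ 2 - (X 0 + C (b 0)) ^ 3) *
        (X 2 ^ 2 + (X 5 + 1) ^ 3 + (X 3 + C (b 3)) ^ 7 + X 4 ^ 8 + (X 0 + C (b 0)) ^ 12) := by
    simp only [τ, map_mul, map_add, map_sub, map_pow, aeval_X, h1, h2, h4, h5, C_0, C_1, add_zero]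
  rw [map_pow, hE, show 7 - 1 = 6 from rfl, DoublePointFedder.mem_span_X_pow_iff] at hmem'
  have hsupp : (Finsupp.equivFunOnFinite.symm ![0, 6, 6, 0, 0, 6] : Fin 6 →₀ ℕ) ∈
      (((X 5 + 1 - X 1 ^ 2 - (X 0 + C (b 0)) ^ 3) *
        (X 2 ^ 2 + (X 5 + 1) ^ 3 + (X 3 + C (b 3)) ^ 7 + X 4 ^ 8 + (X 0 + C (b 0)) ^ 12)) ^ 6 :
          MvPolynomial (Fin 6) K).support := by
    rw [mem_support_iff, coeff_translate (b 0) (b 3) hx hw]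
    exact neg_10800_ne_zero
  obtain ⟨i, hi⟩ := hmem' _ hsupp
  rw [Finsupp.coe_equivFunOnFinite_symm] at hi
  fin_cases i <;> simp at hi

end Translate

/-- **FEDDER'S TEST FOR `T⁽⁴⁾⁺` AT THE SINGULAR CIRCLE, `p = 7`** (the form the residue-point dictionary
`FrobeniusPowerOfFedderAt.frobeniusPower_of_fedderAt` consumes): for `F₁ = Φ − y² − x³`, `F₂ = z² + Φ³ + w⁷ + v⁸ + x¹²` over a
field `k` of characteristic `7`, a field `K ⊇ k` and a `K`-point `b` with `b_y = b_z = b_v = 0`, `b_x³ = 1`, `b_Φ = 1`,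
`b_w⁷ = −2`: `((F₁F₂) ⊗ K)⁶ ∉ ((Xᵢ − bᵢ)⁷)`. THE THREE SINGULAR POINTS OF `T⁽⁴⁾⁺` OFF `V(x, Φ)` ARE F-PURE.
[cite: Fedder1983, Prop. 1.7 and Prop. 2.1] -/
theorem t4Plus_fedder_circle {k : Type} [Field k] [CharP k 7] (F₁ F₂ : MvPolynomial (Fin 6) k)
    (hF₁ : F₁ = X 5 - X 1 ^ 2 - X 0 ^ 3) (hF₂ : F₂ = X 2 ^ 2 + X 5 ^ 3 + X 3 ^ 7 + X 4 ^ 8 + X 0 ^ 12)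
    {K : Type} [Field K] [Algebra k K] (b : Fin 6 → K) (h1 : b 1 = 0) (h2 : b 2 = 0) (h4 : b 4 = 0)
    (hx : b 0 ^ 3 = 1) (h5 : b 5 = 1) (hw : b 3 ^ 7 = -2) :
    (MvPolynomial.map (algebraMap k K) (F₁ * F₂)) ^ (7 - 1) ∉
      Ideal.span (Set.range fun i : Fin 6 => (MvPolynomial.X i - MvPolynomial.C (b i)) ^ 7) := by
  haveI : CharP K 7 := charP_of_injective_algebraMap (algebraMap k K).injective 7
  have hmapF : MvPolynomial.map (algebraMap k K) (F₁ * F₂) =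
      (X 5 - X 1 ^ 2 - X 0 ^ 3) * (X 2 ^ 2 + X 5 ^ 3 + X 3 ^ 7 + X 4 ^ 8 + X 0 ^ 12) := by
    rw [hF₁, hF₂]; simp only [map_mul, map_sub, map_add, map_pow, map_X]
  rw [hmapF]
  exact fedder_circle_core b h1 h2 h4 hx h5 hw

end Summit.ResolutionOfSingularities.ResolutionOfSingularities.Theorems.FInjectiveMacaulayfication.T4PlusFedderData

end
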